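import Literature.Barriers.CriticalPhenomena.LaceExpansionPcAssembly
import Literature.Barriers.CriticalPhenomena.LaceExpansionXSpaceLemma15Diagrams
import Literature.Barriers.CriticalPhenomena.LaceExpansionXSpaceAsymptoticsProofs
import HarnessLib

/-!
# `η = 0` in `x`-space for `d ≥ 11` (`Hara2008_etaZeroXSpace`): the trust base after the
# Gaussian lemma and the diagram reductions — four printed inputs, resp. five leaf facts

Barrier catalogue `Literature/Barriers/CriticalPhenomena/` (D-0021). Pure assembly (no new
statements) joining three proved developments about the named fact `Hara2008_etaZeroXSpace`
(`LaceExpansionHighDimension.lean`; Heydenreich–van der Hofstad 2017, Thm. 11.4: for percolation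
with `d ≥ 11`, `τ_{p_c}(x) = A₂|x|^{2-d}(1 + O(|x|^{-2/d}))`; Hara 2008, Thm. 1.1):

* `LaceExpansionPcAssembly.lean`: `Hara2008_etaZeroXSpace_of_fiveInputs` — Hara's "framework of
  the proof" (§1.2 and Appendix A) proved, leaving the subcritical lace expansion
  `Hara2008_prop12Subcrit`, the diagrammatic Lemmas 1.5–1.6 (`Hara2008_lemma15Pc`,
  `Hara2008_lemma16Pc`), the analytic Lemma 1.7 (`Hara2008_lemma17Pc`) and the Gaussian lemma
  Cor. 1.4 (`Hara2008_gaussianConvolution`);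
* `LaceExpansionXSpaceAsymptoticsProofs.lean`: `Hara2008_gaussianConvolution_holds` — Cor. 1.4 is
  a theorem (Thm. 1.3 via Lemmas 2.2–2.3, §2, proved in `LaceExpansionGaussianLemma*.lean`,
  `LaceExpansionGaussianLargeT.lean`, `HaraGaussianLemma*.lean`);
* `LaceExpansionXSpaceLemma15Diagrams.lean` / `LaceExpansionXSpaceLemma16.lean`:
  `Hara2008_lemma15Pc_of_diagramBounds`, `Hara2008_lemma16Pc_of_diagramBounds` — Lemmas 1.5 and
  1.6 from the Hara–Slade diagram bounds on `Π^{(N)}_{p_c}` (`HvdH2017_piNDiagramBoundPc`, shared)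
  and Hara's two analytic diagram estimates (`Hara2008_twoLongLinesDiagramBoundPc`, §3.5;
  `Hara2008_weightedNLoopBoundPc`, §3.4). `HvdH2017_piNDiagramBoundPc` is vendored in
  CONDITIONAL form (the decomposition `Π_{p_c} = Σ_N (-1)^N Π^{(N)}` with its BK bounds, GIVEN the
  summability of the explicit diagrams at `p_c` — review of the split, D-0026); its hypothesis
  is discharged here from the other leaves (`piNDecompositionPc_of_leafInputs`: the second
  moment of `Π_{p_c}` from `Hara2008_prop12Subcrit`, Lemma 1.7 at `φ = 2` for the finiteness of
  `W̄^{(0,0)}, T̄^{(0,0)}, H̄^{(0)}`, and `Hara2008_weightedNLoopBoundPc` at `β = γ = 0`,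
  `tsum_piNDiagramPc_ne_top_of_weightedBound`), which gives back the unconditional decomposition
  consumed by the Lemma 1.5 assembly.

## Main results (all proved; namespace `Literature.Barriers.CriticalPhenomena`)

* `Hara2008_laceExpansionPc_of_fourInputs`, `Hara2008_etaZeroXSpace_of_fourInputs` — the FOUR
  printed inputs `Hara2008_prop12Subcrit`, `Hara2008_lemma15Pc`, `Hara2008_lemma16Pc`,
  `Hara2008_lemma17Pc` suffice (the Gaussian lemma being proved);
* `piNDecompositionPc_of_leafInputs` — the unconditional Hara–Slade decomposition at `p_c` with
  its diagram bounds (the former statement of `HvdH2017_piNDiagramBoundPc`) from the conditional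
  fact and `Hara2008_weightedNLoopBoundPc`, `Hara2008_prop12Pc`, `Hara2008_lemma17Pc`;
* `Hara2008_laceExpansionPc_of_leafInputs`, `Hara2008_etaZeroXSpace_of_leafInputs` — equivalently
  the FIVE leaf facts `Hara2008_prop12Subcrit` (Hara 2008, Prop. 1.2 for `p < p_c` with `p`-uniform
  bounds, `d ≥ 11`: Hara–Slade 1990 and Fitzner–van der Hofstad 2017), `HvdH2017_piNDiagramBoundPc`
  (the expansion `Π_{p_c} = Σ_N (-1)^N Π^{(N)}` with the BK diagram bounds (7.2.9), (7.4.10), given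
  the summability of those diagrams at `p_c`), `Hara2008_twoLongLinesDiagramBoundPc` (§3.5),
  `Hara2008_weightedNLoopBoundPc` (§3.4) and `Hara2008_lemma17Pc` (Lemma 1.7, §4).

This is the complete list of unproved statements on which `Hara2008_etaZeroXSpace` rests in the
catalogue at this point; each is a statement printed in the sources, cited at its definition.

## References

* T. Hara, *Decay of correlations in nearest-neighbor self-avoiding walk, percolation, lattice
  trees and animals*, Ann. Probab. 36 (2008) 530–593 (arXiv:math-ph/0504021): Thm. 1.1, §1.2
  (framework of the proof: Prop. 1.2, Thm. 1.3, Cor. 1.4, Lemmas 1.5–1.7), §3.4–§3.5, §4,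
  Appendix A.
* M. Heydenreich, R. van der Hofstad, *Progress in High-Dimensional Percolation and Random
  Graphs*, Springer 2017: Thm. 11.4 and pp. 137–139; (7.2.9), (7.4.10).
* R. Fitzner, R. van der Hofstad, Electron. J. Probab. 22 (2017) no. 43: Thms. 1.1, 1.4 and §7.
-/

noncomputable section

namespace Literature.Barriers.CriticalPhenomena

open Literature.Probability.LatticeModels Literature.Probability.Percolation

open scoped ENNReal

/-- **`Hara2008_laceExpansionPc` from four printed inputs**: the subcritical lace expansion
(`Hara2008_prop12Subcrit`) and Hara's Lemmas 1.5, 1.6, 1.7 — the fifth input of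
`Hara2008_laceExpansionPc_of_fiveInputs`, the Gaussian lemma Cor. 1.4, is the theorem
`Hara2008_gaussianConvolution_holds`.
[cite: Hara2008, §1.2 (framework of the proof) and Appendix A; Cor. 1.4] -/
theorem Hara2008_laceExpansionPc_of_fourInputs (hS : Hara2008_prop12Subcrit)
    (h15 : Hara2008_lemma15Pc) (h16 : Hara2008_lemma16Pc) (h17 : Hara2008_lemma17Pc) :
    Hara2008_laceExpansionPc :=
  Hara2008_laceExpansionPc_of_fiveInputs hS h15 h16 h17 Hara2008_gaussianConvolution_holds

/-- **`η = 0` in `x`-space for `d ≥ 11` (Heydenreich–van der Hofstad 2017, Thm. 11.4) from four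
printed inputs**: `Hara2008_prop12Subcrit` and Hara's Lemmas 1.5, 1.6, 1.7; the Gaussian lemma
(Thm. 1.3/Cor. 1.4) and the framework of §1.2/Appendix A are proved.
[cite: Hara2008, Thm. 1.1 and §1.2 (framework of the proof)]
[cite: HeydenreichVanDerHofstad2017, Thm. 11.4 and pp. 137–139] -/
theorem Hara2008_etaZeroXSpace_of_fourInputs (hS : Hara2008_prop12Subcrit)
    (h15 : Hara2008_lemma15Pc) (h16 : Hara2008_lemma16Pc) (h17 : Hara2008_lemma17Pc) :
    Hara2008_etaZeroXSpace :=
  Hara2008_etaZeroXSpace_of_laceExpansionPc (Hara2008_laceExpansionPc_of_fourInputs hS h15 h16 h17)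

/-- **The Hara–Slade decomposition at `p_c`, unconditionally, from the leaf facts**: for every
`d ≥ 11` and the lace-expansion coefficient `Φ` at `p_c` there are `Π^{(N)} ≥ 0`, jointly summable
in `(N, x)`, with `Φ = Σ_N (-1)^N Π^{(N)}`, `Π^{(0)} ≤ τ² - δ₀`, `Π^{(N)} ≤ piNDiagramPc d N`
(`N ≥ 1`) — the former (unconditional) statement of `HvdH2017_piNDiagramBoundPc`. Its hypothesis,
the summability of the explicit diagrams at `p_c`, is supplied by
`tsum_piNDiagramPc_ne_top_of_weightedBound` from Hara's weighted `N`-loop estimate at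
`β = γ = 0` (`Hara2008_weightedNLoopBoundPc`, where "`λ` sufficiently small" lives), whose
finiteness hypotheses `W̄^{(0,0)}, T̄^{(0,0)}, H̄^{(0)} < ∞` are Lemma 1.7 at `φ = 2`
(`Hara2008_lemma17Pc`) applied to the second moment `Σ_x |x|² |Π_{p_c}(x)| < ∞` of Prop. 1.2
(`Hara2008_prop12Pc`; the weighted quantities do not depend on which coefficient carries the
moment). [cite: Hara2008, Prop. 1.2, Lemma 1.7 and §3.4 (Summary)]
[cite: HeydenreichVanDerHofstad2017, Cor. 8.13 ((8.5.2) and its proof)] -/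
theorem piNDecompositionPc_of_leafInputs (hD : HvdH2017_piNDiagramBoundPc)
    (hW : Hara2008_weightedNLoopBoundPc) (hP : Hara2008_prop12Pc) (h17 : Hara2008_lemma17Pc) :
    ∀ (d : ℕ), 11 ≤ d → ∀ Φ : Site d → ℝ, IsLaceCoefficientPc d Φ →
      ∃ P : ℕ → Site d → ℝ,
        (∀ N x, 0 ≤ P N x) ∧
        (Summable fun Nx : ℕ × Site d => P Nx.1 Nx.2) ∧
        (∀ x, HasSum (fun N => (-1 : ℝ) ^ N * P N x) (Φ x)) ∧
        (∀ x, P 0 x ≤ tau d (criticalProbI d) 0 x ^ 2 - if x = 0 then 1 else 0) ∧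
        (∀ N, 1 ≤ N → ∀ x, ENNReal.ofReal (P N x) ≤ piNDiagramPc d N x) := by
  intro d hd Φ hΦ
  have hd1 : 1 ≤ d := by omega
  -- the second moment of `Π_{p_c}` (Prop. 1.2) and Lemma 1.7 at `φ = 2`: `W̄^{(0,0)}, T̄^{(0,0)},
  -- `H̄^{(0)}` are finite
  obtain ⟨Φ', hΦ', hmom⟩ := hP d hd
  have hmom' : Summable fun x : Site d => euclidNorm x ^ (2 : ℝ) * |Φ' x| := by
    refine hmom.congr fun x => ?_
    rw [show (2 : ℝ) = ((2 : ℕ) : ℝ) by norm_num, Real.rpow_natCast]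
  obtain ⟨-, hWc, hTc, -, hHc⟩ := h17 d hd Φ' hΦ' 2 (by norm_num) hmom'
  have hd' : (11 : ℝ) ≤ d := by exact_mod_cast hd
  have h2floor : (⌊(2 : ℝ)⌋ : ℝ) = 2 := by norm_num
  have h0floor : (⌊(0 : ℝ)⌋ : ℝ) = 0 := by norm_num
  have hW00 : haraWBar d 0 0 < ⊤ :=
    hWc 0 0 le_rfl le_rfl not_isOddInt_zero not_isOddInt_zero (by rw [h2floor]; norm_num)
      (by rw [h2floor]; norm_num) (by linarith) (by rw [h0floor]; norm_num)
  have hT00 : haraTBar d 0 0 < ⊤ :=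
    hTc 0 0 le_rfl le_rfl not_isOddInt_zero not_isOddInt_zero (by rw [h2floor]; norm_num)
      (by rw [h2floor]; norm_num) (by linarith) (by rw [h0floor]; norm_num)
  have hH0 : haraHBar d 0 < ⊤ :=
    hHc 0 le_rfl not_isOddInt_zero (by rw [h2floor]; norm_num) (by linarith) (by omega)
  -- Hara's `N`-loop bound at `β = γ = 0` gives the summability of the diagrams at `p_c`
  obtain ⟨c, ρ, hρ0, hρ1, hB⟩ := hW d hd 0 0 le_rfl le_rfl hW00 hW00 hT00 hH0
  have hfin : (∑' N : ℕ, ∑' x : Site d, piNDiagramPc d N x) ≠ ⊤ :=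
    tsum_piNDiagramPc_ne_top_of_weightedBound hd1 (by norm_num) hW00 hρ0 hρ1 hB
  exact hD d hd hfin Φ hΦ

/-- **`Hara2008_laceExpansionPc` from the five leaf facts**: the subcritical lace expansion
(`Hara2008_prop12Subcrit`), the Hara–Slade diagram bounds on the coefficients `Π^{(N)}_{p_c}`
(`HvdH2017_piNDiagramBoundPc`, made unconditional by `piNDecompositionPc_of_leafInputs`), Hara's
two-long-lines estimate (§3.5, `Hara2008_twoLongLinesDiagramBoundPc`, giving Lemma 1.5 by
`Hara2008_lemma15Pc_of_diagramBounds`), Hara's weighted `N`-loop estimate (§3.4,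
`Hara2008_weightedNLoopBoundPc`, giving Lemma 1.6 by `Hara2008_lemma16Pc_of_diagramBounds`) and
the analytic Lemma 1.7 (`Hara2008_lemma17Pc`).
[cite: Hara2008, §1.2, Lemmas 1.5–1.7, §3.4–§3.5 and Appendix A]
[cite: HeydenreichVanDerHofstad2017, (7.2.9) and (7.4.10)] -/
theorem Hara2008_laceExpansionPc_of_leafInputs (hS : Hara2008_prop12Subcrit)
    (hD : HvdH2017_piNDiagramBoundPc) (hL : Hara2008_twoLongLinesDiagramBoundPc)
    (hW : Hara2008_weightedNLoopBoundPc) (h17 : Hara2008_lemma17Pc) : Hara2008_laceExpansionPc :=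
  Hara2008_laceExpansionPc_of_fourInputs hS
    (Hara2008_lemma15Pc_of_diagramBounds
      (piNDecompositionPc_of_leafInputs hD hW (Hara2008_prop12Pc_of_subcrit' hS) h17) hL)
    (Hara2008_lemma16Pc_of_diagramBounds hD hW) h17

/-- **`η = 0` in `x`-space for `d ≥ 11` (Heydenreich–van der Hofstad 2017, Thm. 11.4) from the
five leaf facts** `Hara2008_prop12Subcrit`, `HvdH2017_piNDiagramBoundPc`,
`Hara2008_twoLongLinesDiagramBoundPc`, `Hara2008_weightedNLoopBoundPc`, `Hara2008_lemma17Pc` — the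
complete list of unproved statements behind `Hara2008_etaZeroXSpace` in the catalogue at this point.
[cite: Hara2008, Thm. 1.1, §1.2, §3.4–§3.5, §4 and Appendix A]
[cite: HeydenreichVanDerHofstad2017, Thm. 11.4 and pp. 137–139] -/
theorem Hara2008_etaZeroXSpace_of_leafInputs (hS : Hara2008_prop12Subcrit)
    (hD : HvdH2017_piNDiagramBoundPc) (hL : Hara2008_twoLongLinesDiagramBoundPc)
    (hW : Hara2008_weightedNLoopBoundPc) (h17 : Hara2008_lemma17Pc) : Hara2008_etaZeroXSpace :=
  Hara2008_etaZeroXSpace_of_laceExpansionPc (Hara2008_laceExpansionPc_of_leafInputs hS hD hL hW h17)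

end Literature.Barriers.CriticalPhenomena

end
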